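import Literature.Probability.LatticeModels.FKInterfaceDrivingLocality
import Literature.Probability.Percolation.InterfaceScalingLimitDiscretised
import HarnessLib

/-!
# The bond interface on atoms of the exploration filtration: orientation and driving locality

Route `CardyComplexCone` (sub-problem `CriticalPhenomena/CardyFormulaZ2`), crux
`Summit.CriticalPhenomena.CardyFormulaZ2.Theses.CardyComplexCone.ParafermionToSLESixFamilies`
(item stmt-CriticalPhenomena-11389), line `caratheodory-net-slit-uniformity`, stub
`stub_slitMartingaleData`, internal step (4d) "capacity bookkeeping": measurability of the
capacity driving process `V^k_u = drivingFunction φ_k (bondInterfaceIn D (Λ δ_k) ·) u`, `u ≤ s`,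
with respect to the stopped σ-algebra of the exploration filtration, and the class-function
property of the capacity clock. The tree proves these for the FK interface curve
`fkInterfaceCurve D E ω` (`FKInterfaceDrivingLocality.lean`: re-orientation of the vertex list by
`orientChord D`); the bond-percolation interface of the `CardyFormulaZ2` cruxes is
`bondInterfaceIn D E ω` (`InterfaceScalingLimitDiscretised.lean`: re-orientation of the
parametrised polyline by `orientCurve D`). Both are built on the same list
`medialExploration E ω`, and under the orientation condition "the start vertex `e_a` is at least
as close to `a` as to `b`" neither device reverses anything, so the two curve classes COINCIDE
(`bondInterfaceIn_eq_fkInterfaceCurve`) and every locality theorem of the FK file transfers: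

* `bondInterfaceIn_eq_mk_polyline`, `bondInterfaceIn_eq_fkInterfaceCurve`;
* `drivingFunction_bondInterfaceIn_eqOn_of_mem_explorationCylinder` (registered glue of the
  skeleton) — on the atom `C_n(ω₀)` the driving functions agree up to the capacity time of the
  explored piece `γ[0, n+1]`;
* `image_trace_drivingFunction_bondInterfaceIn_eq_of_mem_explorationCylinder` — the capacity time
  of `γ[0, n+1]` is a class function of `C_n` (whence capacity stopping steps are stopping times,
  `DiscreteDobrushin.isStoppingTime_explorationFiltration_of_forall_mem`);
* `existsUnique_capacityTime_explorationPrefix_bond`, `capacityTime_explorationPrefix_mono_bond`.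

(For the other orientation — `e_a` closer to `b`, the exploration running from `b` to `a` and
`bondInterfaceIn` reversing it — the relevant filtration is that of the reversed exploration; not
treated here.)
-/

noncomputable section

open MeasureTheory Set
open Literature.Probability Literature.Probability.LatticeModels Literature.Probability.Percolation
open Literature.Probability.RandomPlanarGeometry
open Literature.Probability.LatticeModels.DiscreteDobrushin
open UpperHalfPlane (upperHalfPlaneSet)
open scoped unitInterval NNReal

namespace Summit.CriticalPhenomena.CardyFormulaZ2.Cruxes.ParafermionToSLESixFamilies.CaratheodoryNetSlitUniformity

variable {E : DiscreteDobrushin} {D D' : DobrushinDomain}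
  {φ : ConformalEquiv upperHalfPlaneSet D'.carrier}

/-! ### Orientation -/

/-- **Orientation of the bond interface.** If the medial vertex `e_a` of the start corner is at
least as close to `a = D.pt 0` as to `b = D.pt 1`, then `orientCurve D` does not reverse the
exploration polyline and `bondInterfaceIn D E ω` is the class of the polyline itself. -/
theorem bondInterfaceIn_eq_mk_polyline (D : DobrushinDomain) (hE : E.IsZdAdmissible)
    (ω : BondConfig (Site 2))
    (h : dist (medialPoint E.δ (cSrc (startCorner hE))) (D.pt 0) ≤
      dist (medialPoint E.δ (cSrc (startCorner hE))) (D.pt 1)) :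
    bondInterfaceIn D E ω =
      CurveClass.mk ⟨polyline ((medialExploration E ω).map (medialPoint E.δ))⟩ := by
  obtain ⟨l, hl⟩ := medialExploration_eq_cons hE ω
  rw [bondInterfaceIn_apply, medialExplorationCurve]
  have h0 : polyline ((medialExploration E ω).map (medialPoint E.δ)) 0 =
      medialPoint E.δ (cSrc (startCorner hE)) := by
    rw [hl, List.map_cons, polyline_apply_zero]
  rw [orientCurve_of_le D (by rw [h0]; exact h)]

/-- **Under the orientation condition the two tree interfaces of the exploration agree**: the
bond-percolation interface `bondInterfaceIn D E ω` (`orientCurve`) equals the FK interface curve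
`fkInterfaceCurve D E ω` (`orientChord`), both being the class of the exploration polyline. -/
theorem bondInterfaceIn_eq_fkInterfaceCurve (D : DobrushinDomain) (hE : E.IsZdAdmissible)
    (ω : BondConfig (Site 2))
    (h : dist (medialPoint E.δ (cSrc (startCorner hE))) (D.pt 0) ≤
      dist (medialPoint E.δ (cSrc (startCorner hE))) (D.pt 1)) :
    bondInterfaceIn D E ω = fkInterfaceCurve D E ω := by
  rw [bondInterfaceIn_eq_mk_polyline D hE ω h, fkInterfaceCurve_eq_mk_polyline D hE ω h]

/-! ### Driving locality on atoms -/

/-- **Locality of the driving function of the bond interface (the `𝓕_n`-measurability input;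
registered glue of the skeleton).** Let `φ` be a chordal uniformizing map of a Dobrushin domain
`(D'; a', b')` through which the interface classes of `ω` and `ω₀` are describable by the Loewner
evolution (`W_ω = drivingFunction φ (bondInterfaceIn D E ω)`), the orientation condition holding.
If `ω ∈ C_n(ω₀)` — the two explorations have the same first `n + 2` medial vertices — then
`W_ω = W_{ω₀}` on `[0, T]` for every `T` whose trace segment lies in the explored piece,
`Φ(trace W_ω [0, T]) ⊆ γ_ω[0, n+1] = range (polyline (explorationPrefix E n ω))`: the driving
function up to the capacity time of `γ[0, n+1]` is a function of `γ[0, n+1]` (the tree's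
`drivingFunction_fkInterfaceCurve_eqOn_of_mem_explorationCylinder` through
`bondInterfaceIn_eq_fkInterfaceCurve`). -/
theorem drivingFunction_bondInterfaceIn_eqOn_of_mem_explorationCylinder : ∀ {E : DiscreteDobrushin} {D D' : DobrushinDomain} {φ : ConformalEquiv upperHalfPlaneSet D'.carrier} (hE : E.IsZdAdmissible), dist (medialPoint E.δ (cSrc (startCorner hE))) (D.pt 0) ≤ dist (medialPoint E.δ (cSrc (startCorner hE))) (D.pt 1) → D'.IsChordalUniformizing φ → ∀ {ω₀ ω : BondConfig (Site 2)} {n : ℕ}, ω ∈ explorationCylinder hE ω₀ n → IsLoewnerDescribable φ (bondInterfaceIn D E ω) → IsLoewnerDescribable φ (bondInterfaceIn D E ω₀) → ∀ {T : ℝ≥0}, φ.boundaryExtension '' (Loewner.trace (drivingFunction φ (bondInterfaceIn D E ω)) '' Icc 0 T) ⊆ range (polyline ((explorationPrefix E n ω).map (medialPoint E.δ))) → EqOn (drivingFunction φ (bondInterfaceIn D E ω)) (drivingFunction φ (bondInterfaceIn D E ω₀)) (Icc 0 T) := by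
  intro E D D' φ hE horient hφ ω₀ ω n hω hd hd₀ T hT
  rw [bondInterfaceIn_eq_fkInterfaceCurve D hE ω horient] at hd hT ⊢
  rw [bondInterfaceIn_eq_fkInterfaceCurve D hE ω₀ horient] at hd₀ ⊢
  exact drivingFunction_fkInterfaceCurve_eqOn_of_mem_explorationCylinder hE horient hφ hω hd hd₀ hT

/-- **The capacity time of `γ[0, n+1]` is a class function of `C_n`** (bond form of
`image_trace_drivingFunction_fkInterfaceCurve_eq_of_mem_explorationCylinder`): if `T` is the
capacity time of the explored piece of `ω`, `Φ(trace W_ω [0, T]) = γ_ω[0, n+1]`, then `T` is the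
capacity time of the explored piece of `ω₀`, for `ω ∈ C_n(ω₀)`. Hence "the first step at which the
capacity of `γ[0, n+1]` reaches `t`" is a stopping time of the exploration filtration
(`DiscreteDobrushin.isStoppingTime_explorationFiltration_of_forall_mem`). -/
theorem image_trace_drivingFunction_bondInterfaceIn_eq_of_mem_explorationCylinder
    (hE : E.IsZdAdmissible)
    (horient : dist (medialPoint E.δ (cSrc (startCorner hE))) (D.pt 0) ≤
      dist (medialPoint E.δ (cSrc (startCorner hE))) (D.pt 1))
    (hφ : D'.IsChordalUniformizing φ) {ω₀ ω : BondConfig (Site 2)} {n : ℕ}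
    (hω : ω ∈ explorationCylinder hE ω₀ n)
    (hd : IsLoewnerDescribable φ (bondInterfaceIn D E ω))
    (hd₀ : IsLoewnerDescribable φ (bondInterfaceIn D E ω₀)) {T : ℝ≥0}
    (hT : φ.boundaryExtension '' (Loewner.trace (drivingFunction φ (bondInterfaceIn D E ω)) '' Icc 0 T) =
      range (polyline ((explorationPrefix E n ω).map (medialPoint E.δ)))) :
    φ.boundaryExtension '' (Loewner.trace (drivingFunction φ (bondInterfaceIn D E ω₀)) '' Icc 0 T) =
      range (polyline ((explorationPrefix E n ω₀).map (medialPoint E.δ))) := by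
  rw [bondInterfaceIn_eq_fkInterfaceCurve D hE ω horient] at hd hT
  rw [bondInterfaceIn_eq_fkInterfaceCurve D hE ω₀ horient] at hd₀ ⊢
  exact image_trace_drivingFunction_fkInterfaceCurve_eq_of_mem_explorationCylinder hE horient hφ hω
    hd hd₀ hT

/-- `iff` form of the class-function property of the capacity time of `γ[0, n+1]` on `C_n`
(bond form). -/
theorem image_trace_drivingFunction_bondInterfaceIn_eq_iff_of_mem_explorationCylinder
    (hE : E.IsZdAdmissible)
    (horient : dist (medialPoint E.δ (cSrc (startCorner hE))) (D.pt 0) ≤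
      dist (medialPoint E.δ (cSrc (startCorner hE))) (D.pt 1))
    (hφ : D'.IsChordalUniformizing φ) {ω₀ ω : BondConfig (Site 2)} {n : ℕ}
    (hω : ω ∈ explorationCylinder hE ω₀ n)
    (hd : IsLoewnerDescribable φ (bondInterfaceIn D E ω))
    (hd₀ : IsLoewnerDescribable φ (bondInterfaceIn D E ω₀)) {T : ℝ≥0} :
    φ.boundaryExtension '' (Loewner.trace (drivingFunction φ (bondInterfaceIn D E ω)) '' Icc 0 T) =
        range (polyline ((explorationPrefix E n ω).map (medialPoint E.δ))) ↔
      φ.boundaryExtension '' (Loewner.trace (drivingFunction φ (bondInterfaceIn D E ω₀)) '' Icc 0 T) =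
        range (polyline ((explorationPrefix E n ω₀).map (medialPoint E.δ))) :=
  ⟨image_trace_drivingFunction_bondInterfaceIn_eq_of_mem_explorationCylinder hE horient hφ hω hd hd₀,
    image_trace_drivingFunction_bondInterfaceIn_eq_of_mem_explorationCylinder hE horient hφ
      (mem_explorationCylinder_comm hω) hd₀ hd⟩

/-- **The capacity time of the explored piece exists and is unique** as soon as the target point
`b'` of the describing domain is off the prefix trace `γ[0, n+1]` (bond form of
`existsUnique_capacityTime_explorationPrefix`). -/
theorem existsUnique_capacityTime_explorationPrefix_bond (hE : E.IsZdAdmissible)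
    (horient : dist (medialPoint E.δ (cSrc (startCorner hE))) (D.pt 0) ≤
      dist (medialPoint E.δ (cSrc (startCorner hE))) (D.pt 1))
    (hφ : D'.IsChordalUniformizing φ) {ω : BondConfig (Site 2)} {n : ℕ}
    (hd : IsLoewnerDescribable φ (bondInterfaceIn D E ω))
    (hb : D'.pt 1 ∉ range (polyline ((explorationPrefix E n ω).map (medialPoint E.δ)))) :
    ∃! T : ℝ≥0,
      φ.boundaryExtension '' (Loewner.trace (drivingFunction φ (bondInterfaceIn D E ω)) '' Icc 0 T) =
        range (polyline ((explorationPrefix E n ω).map (medialPoint E.δ))) := by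
  rw [bondInterfaceIn_eq_fkInterfaceCurve D hE ω horient] at hd ⊢
  exact existsUnique_capacityTime_explorationPrefix hE horient hφ hd hb

/-- **Monotonicity of the capacity clock in the explored depth** (bond form of
`capacityTime_explorationPrefix_mono`): if `T_m`, `T_n` are the capacity times of
`γ[0, m+1] ⊆ γ[0, n+1]`, `m ≤ n`, then `T_m ≤ T_n`. -/
theorem capacityTime_explorationPrefix_mono_bond (hE : E.IsZdAdmissible)
    (horient : dist (medialPoint E.δ (cSrc (startCorner hE))) (D.pt 0) ≤
      dist (medialPoint E.δ (cSrc (startCorner hE))) (D.pt 1))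
    {ω : BondConfig (Site 2)} {m n : ℕ} (hmn : m ≤ n)
    (hd : IsLoewnerDescribable φ (bondInterfaceIn D E ω)) {Tm Tn : ℝ≥0}
    (hTm : φ.boundaryExtension '' (Loewner.trace (drivingFunction φ (bondInterfaceIn D E ω)) '' Icc 0 Tm) =
      range (polyline ((explorationPrefix E m ω).map (medialPoint E.δ))))
    (hTn : φ.boundaryExtension '' (Loewner.trace (drivingFunction φ (bondInterfaceIn D E ω)) '' Icc 0 Tn) =
      range (polyline ((explorationPrefix E n ω).map (medialPoint E.δ)))) :
    Tm ≤ Tn := by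
  rw [bondInterfaceIn_eq_fkInterfaceCurve D hE ω horient] at hd hTm hTn
  exact capacityTime_explorationPrefix_mono hE horient hmn hd hTm hTn

end Summit.CriticalPhenomena.CardyFormulaZ2.Cruxes.ParafermionToSLESixFamilies.CaratheodoryNetSlitUniformity

end
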